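import Mathlib
import HarnessLib
import Literature.Geometry.Lorentzian.TameGenericityLocal
import Literature.Geometry.Lorentzian.EventHorizonArea

/-!
# Sketch (crux-ideate round 2, ideator 4) — crux `TameCensorshipCollarMargin`
# (stmt-FinalStateConjecture-17329, route BartnikGapSettling)

First lemmas of the crux idea card `fold-into-the-isologous-leaf` of this seat (ONE card), typed over
existing declarations (`Literature.Geometry.Lorentzian.TameGenericity*`, `EventHorizonArea`). STANDING
PREMISE (as every round-1 card and all four leads): the FILED decl is misstated by inheritance
(un-windowed margin, false modulo `ExtremalJunkCollars ∧ MGHDExists`, p146745); the card is a lever for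
the load-bearing stub of the RESTATED windowed order-2 crux `TameCensorshipCollarMarginW`
(VERDICT-lead0.md §2 = birth stub 2 `stub_windowedThirdLawAlongCensoredCurves` / zdm stub G), reached by
the filed text only after the planner's restatement — never through `stub_unwindowing`.

* §A (the card's lever: DIAL ⊕ FOLD ⊕ ISOLOGOUS NO-OVERSPIN, black-hole side only):
  - `threshold_le_sq_of_semiconvex` (PROVED, Mathlib only): ONE sufficient analytic route to the
    one-sided parabolic LEAF bound — semiconvexity of the final extremality defect from the black-hole
    side forces the extremal leaf, seen in the parameter plane of a 2-probe, to bend toward the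
    black-hole side at most QUADRATICALLY. (The card's primary input (b) is the leaf bound itself =
    "no second-order overspin along ISOLOGOUS tame directions"; transversally the final parameter ratio
    is only `C¹` with `C^{1/2}` horizon data, AKU arXiv:2603.10378 Thm 3, so semiconvexity in fixed
    probe coordinates is not claimed in general.)
  - `shearedParabola`, `fold_escape` (PROVED over `TameGenericityLocal`): the folded curve
    `c ↦ G((μc + Kc²) e₀ + c e₁)` of a tame immersed injective admissible 2-probe is a legal witness of
    tame codimension one (immersion survives through the `e₁`-coordinate), so ONE-SIDED goodness on a
    parabolic horn is all that is ever asked — no member on the non-collapse side `𝔐_non` is visited.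
  - `escape_of_blackSideChart` (PROVED): black-side isologous chart + one-sided parabolic leaf bound ⇒
    escape; `ParabolicAccessFromBlackSide`, `isTameChristodoulouGeneric_of_parabolicAccess` (kernel
    Prop + PROVED reduction).
* §B (remark R of the card — WHICH probe class needs second order; not a separate card):
  - `kerrMassSq`, `hasDerivAt_kerrMassSq_area_extremal`, `hasDerivAt_extremalityDefect_line`
    (PROVED, Mathlib only): with the Christodoulou–Ruffini mass formula `M(A,J)² = A/16π + 4πJ²/A`, the
    horizon extremality defect `M² − |J|` is stationary along every line through an extremal section
    `A = 8π|J|` — the first law at zero temperature. Along CHARGE-PRESERVING probes at data whose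
    horizon no longer absorbs after the slice, this is why first-order transversals vanish (kflux's
    tangency); it says NOTHING transversally (horizon area is only `C^{1/2}` across the threshold), and
    a far-field DIAL is first-order transversal even there.
  - `TameRegularAt`, `AreaFrozenFrom`, `ZeroTemperatureDichotomy`, `escape_of_dichotomy` (typed Props
    + PROVED bookkeeping): how the fold (regular data) and the K-flux seed (the residual class, if one
    insists on charge-preserving probes) compose.

Nothing here is a skeleton; no stub is registered.
-/

set_option linter.dupNamespace false
set_option linter.unusedVariables false

noncomputable section

open Set Filter Function Metric
open scoped Manifold ContDiff Topology Real

namespace Summit.FinalStateConjecture.FinalStateConjecture.Cruxes.TameCensorshipCollarMargin.Ideator4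

open Literature.Geometry.Lorentzian Literature.Geometry.Lorentzian.InitialDataSet

/-! ## §A1 Semiconvexity from the black-hole side ⇒ one-sided parabolic bound on the threshold -/

/-- **One-sided parabolic bound from semiconvexity.** In the parameter plane `(s, t)` of a
2-probe through an extremal-threshold datum let the black-hole side be the supergraph `{s ≥ g t}`
of a threshold function `g` with `g 0 = 0`, `g → 0` at `0`, and let `Δ s t` be the final
extremality defect of the member `(s, t)` (meaningful on the black-hole side only), vanishing ON
the threshold. If `Δ` is SEMICONVEX FROM THE BLACK-HOLE SIDE with respect to its linear part
`lam • s` (`lam > 0`: the transversal first variation), i.e.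
`Δ s t ≥ lam s − C (s² + t²)` whenever `g t ≤ s`, then the threshold bends toward the black-hole
side at most quadratically: `g t ≤ (2C/lam) t²` near `0`. ONE sufficient route to the card's input
(b) (the one-sided parabolic leaf bound); the card does not claim semiconvexity in fixed probe
coordinates in general (transversal `C^{1/2}` behaviour, AKU arXiv:2603.10378 Thm 3).
[folklore real analysis] -/
theorem threshold_le_sq_of_semiconvex {g : ℝ → ℝ} {Δ : ℝ → ℝ → ℝ} {lam C ε : ℝ}
    (hlam : 0 < lam) (hC : 0 ≤ C) (hε : 0 < ε)
    (hg0 : Tendsto g (𝓝 0) (𝓝 0))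
    (hzero : ∀ t, |t| < ε → Δ (g t) t = 0)
    (hsemi : ∀ s t, |t| < ε → |s| < ε → g t ≤ s → lam * s - C * (s ^ 2 + t ^ 2) ≤ Δ s t) :
    ∃ ε' > 0, ∀ t, |t| < ε' → g t ≤ (2 * C / lam) * t ^ 2 := by
  -- `η`: how small `g t` must be for the quadratic self-term to be absorbed
  set η : ℝ := min ε (lam / (2 * C + 2)) with hη
  have hηpos : 0 < η := lt_min hε (div_pos hlam (by linarith))
  have hηε : η ≤ ε := min_le_left _ _
  have hηlam : η ≤ lam / (2 * C + 2) := min_le_right _ _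
  -- `g t` is `η`-small for `t` small
  have hsmall : ∀ᶠ t in 𝓝 (0 : ℝ), |g t| < η := by
    have := (Metric.tendsto_nhds.mp hg0) η hηpos
    simpa [Real.dist_eq] using this
  obtain ⟨ε₁, hε₁, hball⟩ := Metric.eventually_nhds_iff.mp hsmall
  refine ⟨min ε ε₁, lt_min hε hε₁, fun t ht ↦ ?_⟩
  have htε : |t| < ε := lt_of_lt_of_le ht (min_le_left _ _)
  have htε₁ : |t| < ε₁ := lt_of_lt_of_le ht (min_le_right _ _)
  have hgt : |g t| < η := hball (by simpa [Real.dist_eq] using htε₁)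
  -- semiconvexity at the threshold point `(g t, t)`
  have key : lam * g t - C * (g t ^ 2 + t ^ 2) ≤ 0 := by
    have h := hsemi (g t) t htε (lt_of_lt_of_le hgt hηε) le_rfl
    rwa [hzero t htε] at h
  have ht2 : 0 ≤ t ^ 2 := sq_nonneg t
  by_cases hpos : g t ≤ 0
  · -- trivial side: the bound is non-negative
    have : 0 ≤ 2 * C / lam * t ^ 2 := by positivity
    linarith
  · push Not at hpos
    -- absorb `C g²` into `lam g / 2` using `g t < η ≤ lam / (2C+2)`
    have hg_lt : g t < lam / (2 * C + 2) := lt_of_lt_of_le (lt_of_abs_lt hgt) hηlam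
    have hCg : C * g t ≤ lam / 2 := by
      have h2C : 0 < 2 * C + 2 := by linarith
      have : C * g t ≤ C * (lam / (2 * C + 2)) :=
        mul_le_mul_of_nonneg_left hg_lt.le hC
      have hfrac : C * (lam / (2 * C + 2)) ≤ lam / 2 := by
        rw [mul_div_assoc', div_le_div_iff₀ h2C (by norm_num : (0:ℝ) < 2)]
        nlinarith
      linarith
    -- `lam g ≤ C g² + C t² ≤ (lam/2) g + C t²`
    have h1 : lam * g t ≤ C * g t * g t + C * t ^ 2 := by nlinarith
    have h2 : C * g t * g t ≤ lam / 2 * g t := by nlinarith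
    have h3 : lam / 2 * g t ≤ C * t ^ 2 := by linarith
    -- divide by `lam / 2 > 0`
    rw [div_mul_eq_mul_div, le_div_iff₀ hlam]
    nlinarith

/-- **Strict horn.** Under the conclusion of `threshold_le_sq_of_semiconvex` (more generally under
any one-sided bound `g t ≤ μ t + K₀ t²`), the sheared parabola `s = μ t + (K₀ + 1) t²` lies
STRICTLY on the black-hole side off `t = 0`. [folklore] -/
theorem lt_shearedParabola_of_le {g : ℝ → ℝ} {μ K₀ ε : ℝ}
    (hg : ∀ t, |t| < ε → g t ≤ μ * t + K₀ * t ^ 2) {t : ℝ} (ht : |t| < ε) (ht0 : t ≠ 0) :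
    g t < μ * t + (K₀ + 1) * t ^ 2 := by
  have := hg t ht
  have hpos : 0 < t ^ 2 := by positivity
  nlinarith

/-! ## §A2 The fold: a sheared parabola in the parameter plane of a tame 2-probe -/

/-- Points of `ℝ¹` are determined by their only coordinate. [folklore] -/
theorem eq_of_apply_zero_eq {c c' : EuclideanSpace ℝ (Fin 1)} (h : c 0 = c' 0) : c = c' := by
  ext i
  have hi : i = 0 := Subsingleton.elim _ _
  subst hi
  simpa using h

/-- `‖c‖ = |c 0|` on `ℝ¹`. [folklore] -/
theorem norm_eq_abs_apply_zero (c : EuclideanSpace ℝ (Fin 1)) : ‖c‖ = |c 0| := by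
  rw [EuclideanSpace.norm_eq, Fin.sum_univ_one, Real.sqrt_sq_eq_abs, abs_norm, Real.norm_eq_abs]

/-- The **sheared parabola** `c ↦ (μ c + K c²) e₀ + c e₁` in the parameter plane of a 2-probe:
the `e₀`-coordinate is folded (one-sided up to the shear `μ`), the `e₁`-coordinate keeps the curve
injective and immersed. -/
def shearedParabola (μ K : ℝ) (c : EuclideanSpace ℝ (Fin 1)) : EuclideanSpace ℝ (Fin 2) :=
  (μ * c 0 + K * (c 0) ^ 2) • EuclideanSpace.single 0 1 + (c 0) • EuclideanSpace.single 1 1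

@[simp] theorem shearedParabola_apply_zero (μ K : ℝ) (c : EuclideanSpace ℝ (Fin 1)) :
    shearedParabola μ K c 0 = μ * c 0 + K * (c 0) ^ 2 := by
  simp [shearedParabola]

@[simp] theorem shearedParabola_apply_one (μ K : ℝ) (c : EuclideanSpace ℝ (Fin 1)) :
    shearedParabola μ K c 1 = c 0 := by
  simp [shearedParabola]

theorem shearedParabola_zero (μ K : ℝ) : shearedParabola μ K 0 = 0 := by
  simp [shearedParabola]

/-- The first coordinate of `ℝ¹` as a smooth function. -/
theorem contDiff_apply_zero : ContDiff ℝ ∞ (fun c : EuclideanSpace ℝ (Fin 1) ↦ c 0) :=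
  contDiff_piLp_apply (𝕜 := ℝ) (p := 2) (E := fun _ : Fin 1 ↦ ℝ) (i := (0 : Fin 1))

theorem contDiff_shearedParabola (μ K : ℝ) : ContDiff ℝ ∞ (shearedParabola μ K) := by
  unfold shearedParabola
  refine ContDiff.add ?_ ?_
  · exact ((contDiff_const.mul contDiff_apply_zero).add
      (contDiff_const.mul (contDiff_apply_zero.pow 2))).smul contDiff_const
  · exact contDiff_apply_zero.smul contDiff_const

theorem injective_shearedParabola (μ K : ℝ) : Injective (shearedParabola μ K) := by
  intro c c' h
  apply eq_of_apply_zero_eq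
  have := congrArg (fun p : EuclideanSpace ℝ (Fin 2) ↦ p 1) h
  simpa using this

/-- The differential of the sheared parabola at `0` is injective: its `e₁`-component is the
identity of `ℝ¹` (read through the continuous linear second-coordinate projection and the chain
rule; no explicit derivative of the quadratic part is needed). -/
theorem injective_fderiv_shearedParabola (μ K : ℝ) :
    Injective (fderiv ℝ (shearedParabola μ K) 0) := by
  set φ := shearedParabola μ K with hφ
  have hdiff : DifferentiableAt ℝ φ 0 :=
    ((contDiff_shearedParabola μ K).differentiable (by simp)).differentiableAt
  -- second coordinate ∘ φ = first coordinate of ℝ¹, a continuous linear map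
  set π₁ : EuclideanSpace ℝ (Fin 2) →L[ℝ] ℝ := EuclideanSpace.proj (1 : Fin 2) with hπ₁
  set π₀ : EuclideanSpace ℝ (Fin 1) →L[ℝ] ℝ := EuclideanSpace.proj (0 : Fin 1) with hπ₀
  have hcomp : (fun c ↦ π₁ (φ c)) = fun c ↦ π₀ c := by
    funext c
    simp [hπ₁, hπ₀, hφ]
  have hchain : fderiv ℝ (fun c ↦ π₁ (φ c)) 0 = π₁.comp (fderiv ℝ φ 0) := by
    change fderiv ℝ (⇑π₁ ∘ φ) 0 = _
    rw [fderiv_comp 0 π₁.differentiableAt hdiff, ContinuousLinearMap.fderiv]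
  have hlin : fderiv ℝ (fun c ↦ π₁ (φ c)) 0 = π₀ := by
    rw [hcomp]
    exact π₀.fderiv
  intro v w hvw
  apply eq_of_apply_zero_eq
  have h := congrArg π₁ hvw
  have hv : π₁ (fderiv ℝ φ 0 v) = v 0 := by
    have := congrArg (fun L : EuclideanSpace ℝ (Fin 1) →L[ℝ] ℝ ↦ L v) (hchain.symm.trans hlin)
    simpa [hπ₀] using this
  have hw : π₁ (fderiv ℝ φ 0 w) = w 0 := by
    have := congrArg (fun L : EuclideanSpace ℝ (Fin 1) →L[ℝ] ℝ ↦ L w) (hchain.symm.trans hlin)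
    simpa [hπ₀] using this
  rw [hv, hw] at h
  exact h

variable {X : Type*} [TopologicalSpace X] [ChartedSpace E3 X] [IsManifold (𝓡 3) ∞ X]

/-- **The fold.** A tame, immersed, injective 2-probe `G` of admissible data whose members ON THE
SHEARED PARABOLA `c ↦ (μ c + K c²) e₀ + c e₁` are good for small `c ≠ 0` yields the tame injective
immersed admissible CURVE through `G 0` all of whose members off `0` are good — exactly the witness
`HasTameCodimAtLeastIn … 1` asks for. Nothing is asked on the other side of the parabola (no
`𝔐_non`, no census). Bookkeeping over the landed `IsTameDataFamily.comp_contDiff`,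
`IsImmersedAtZero.comp_of_injective_fderiv`, `exists_tameFamily_of_local`. [folklore] -/
theorem fold_escape {e : AFEnd X} {𝓓 : Set (InitialDataSet (𝓡 3) X)}
    {P : InitialDataSet (𝓡 3) X → Prop} {G : EuclideanSpace ℝ (Fin 2) → InitialDataSet (𝓡 3) X}
    (hG : IsTameDataFamily e 2 G) (himm : IsImmersedAtZero 2 G) (hinj : Injective G)
    (h𝓓 : ∀ p, G p ∈ 𝓓) (μ K : ℝ) {ε : ℝ} (hε : 0 < ε)
    (hP : ∀ c : EuclideanSpace ℝ (Fin 1), c ≠ 0 → ‖c‖ < ε → P (G (shearedParabola μ K c))) :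
    ∃ F : EuclideanSpace ℝ (Fin 1) → InitialDataSet (𝓡 3) X,
      IsTameDataFamily e 1 F ∧ F 0 = G 0 ∧ Injective F ∧ IsImmersedAtZero 1 F ∧
        (∀ c, F c ∈ 𝓓) ∧ ∀ c ≠ 0, P (F c) := by
  have hT : IsTameDataFamily e 1 (fun c ↦ G (shearedParabola μ K c)) :=
    hG.comp_contDiff (contDiff_shearedParabola μ K) (shearedParabola_zero μ K)
  have hI : IsImmersedAtZero 1 (fun c ↦ G (shearedParabola μ K c)) :=
    himm.comp_of_injective_fderiv (shearedParabola_zero μ K)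
      (((contDiff_shearedParabola μ K).differentiable (by simp)).differentiableAt)
      (injective_fderiv_shearedParabola μ K)
  obtain ⟨F, hF, hF0, hFinj, hFimm, hF𝓓, hFP⟩ :=
    exists_tameFamily_of_local (P := P) hT hI (hinj.comp (injective_shearedParabola μ K))
      (fun c ↦ h𝓓 _) hε hP
  exact ⟨F, hF, by simpa [shearedParabola_zero] using hF0, hFinj, hFimm, hF𝓓, hFP⟩

/-! ## §A3 Black-side chart + one-sided parabolic bound ⇒ escape -/

/-- **Escape from a black-side chart.** Inputs, all ONE-SIDED: a tame immersed injective admissible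
2-probe `G` through the datum; a threshold function `g` on its parameter plane such that members
strictly above the graph (`g (p 1) < p 0`, the sub-extremal basin in the chart) are GOOD; and the
one-sided parabolic bound `g t ≤ μ t + K₀ t²` (from `threshold_le_sq_of_semiconvex`, i.e. from the
dynamical no-second-order-overspin inequality). Output: the tame codimension-one witness through
`G 0`. [folklore] -/
theorem escape_of_blackSideChart {e : AFEnd X} {𝓓 : Set (InitialDataSet (𝓡 3) X)}
    {P : InitialDataSet (𝓡 3) X → Prop} {G : EuclideanSpace ℝ (Fin 2) → InitialDataSet (𝓡 3) X}
    (hG : IsTameDataFamily e 2 G) (himm : IsImmersedAtZero 2 G) (hinj : Injective G)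
    (h𝓓 : ∀ p, G p ∈ 𝓓) {g : ℝ → ℝ} {μ K₀ ε : ℝ} (hε : 0 < ε)
    (hgood : ∀ p : EuclideanSpace ℝ (Fin 2), ‖p‖ < ε → g (p 1) < p 0 → P (G p))
    (hg : ∀ t, |t| < ε → g t ≤ μ * t + K₀ * t ^ 2) :
    ∃ F : EuclideanSpace ℝ (Fin 1) → InitialDataSet (𝓡 3) X,
      IsTameDataFamily e 1 F ∧ F 0 = G 0 ∧ Injective F ∧ IsImmersedAtZero 1 F ∧
        (∀ c, F c ∈ 𝓓) ∧ ∀ c ≠ 0, P (F c) := by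
  -- the parabola is continuous at `0` with value `0`: its points are `ε`-small for `c` small
  have hcont : Tendsto (shearedParabola μ (K₀ + 1)) (𝓝 0) (𝓝 0) := by
    simpa [shearedParabola_zero] using
      ((contDiff_shearedParabola μ (K₀ + 1)).continuous.continuousAt (x := 0)).tendsto
  obtain ⟨δ, hδ, hballδ⟩ := (Metric.tendsto_nhds_nhds.mp hcont) ε hε
  refine fold_escape hG himm hinj h𝓓 μ (K₀ + 1) (lt_min hδ hε) fun c hc hcn ↦ ?_
  have hcδ : ‖c‖ < δ := lt_of_lt_of_le hcn (min_le_left _ _)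
  have hcε : ‖c‖ < ε := lt_of_lt_of_le hcn (min_le_right _ _)
  have hp : ‖shearedParabola μ (K₀ + 1) c‖ < ε := by
    simpa using hballδ (x := c) (by simpa using hcδ)
  refine hgood _ hp ?_
  have hc0 : c 0 ≠ 0 := fun h ↦ hc (eq_of_apply_zero_eq (by simpa using h))
  have hct : |c 0| < ε := by simpa [norm_eq_abs_apply_zero] using hcε
  simpa using lt_shearedParabola_of_le hg hct hc0

/-- **Kernel statement of card A (`fold-into-the-isologous-leaf`): PARABOLIC ACCESS TO THE GOOD
BASIN FROM THE BLACK-HOLE SIDE.** Through every exceptional admissible datum there is a tame immersed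
injective admissible 2-probe and a threshold function `g` on its parameter plane such that members
strictly above the graph are good and `g` obeys a one-sided parabolic bound. For the crux:
`Good D := (every MGHD has complete 𝓘⁺) ∧ (windowed collar margin W)`; the card supplies this at
TAME-REGULAR extremal-threshold data (black-side isologous chart + dynamical no-overspin), defers
isolated-horizon data to the K-flux seed and naked data to the censorship stub. -/
def ParabolicAccessFromBlackSide (𝓓 : Set (InitialDataSet (𝓡 3) X))
    (Exc Good : InitialDataSet (𝓡 3) X → Prop) : Prop :=
  ∀ d ∈ 𝓓, Exc d →
    ∃ (e : AFEnd X) (G : EuclideanSpace ℝ (Fin 2) → InitialDataSet (𝓡 3) X) (g : ℝ → ℝ)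
      (μ K₀ ε : ℝ), 0 < ε ∧ IsTameDataFamily e 2 G ∧ IsImmersedAtZero 2 G ∧ Injective G ∧
      G 0 = d ∧ (∀ p, G p ∈ 𝓓) ∧
      (∀ p : EuclideanSpace ℝ (Fin 2), ‖p‖ < ε → g (p 1) < p 0 → Good (G p)) ∧
      (∀ t, |t| < ε → g t ≤ μ * t + K₀ * t ^ 2)

/-- Parabolic access from the black-hole side at EVERY exceptional datum gives tame codimension one
(the strongest, census-free form; the card claims it only on the tame-regular threshold stratum and
composes with the other levers via `escape_of_dichotomy` below). [folklore] -/
theorem isTameChristodoulouGeneric_of_parabolicAccess {𝓓 : Set (InitialDataSet (𝓡 3) X)}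
    {Good : InitialDataSet (𝓡 3) X → Prop}
    (h : ParabolicAccessFromBlackSide 𝓓 (fun d ↦ ¬ Good d) Good) :
    IsTameChristodoulouGeneric 𝓓 Good 1 := by
  refine isTameChristodoulouGeneric_of_local fun d hd hnot ↦ ?_
  obtain ⟨e, G, g, μ, K₀, ε, hε, hG, himm, hinj, h0, h𝓓, hgood, hg⟩ := h d hd hnot
  obtain ⟨F, hF, hF0, hFinj, hFimm, hF𝓓, hFP⟩ :=
    escape_of_blackSideChart (P := Good) hG himm hinj h𝓓 hε hgood hg
  exact ⟨e, F, hF, hFimm, hF0.trans h0, hFinj, hF𝓓, 1, one_pos, fun c hc _ ↦ hFP c hc⟩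

/-! ## §B1 (remark R) The first law at zero temperature: along charge-preserving probes at non-absorbing
data the defect does not see first-order charge variations -/

/-- The **Christodoulou–Ruffini / Smarr mass formula** of a Kerr horizon section of area `A` and
angular momentum `J`: `M(A,J)² = A/(16π) + 4πJ²/A` (so `M² = M_irr² + J²/(4M_irr²)`,
`A = 16π M_irr²`). Used on isolated-horizon sections (Ashtekar–Beetle–Lewandowski mechanics).
[cite: ChristodoulouRuffini1971; AshtekarBeetleLewandowski2001] -/
def kerrMassSq (A J : ℝ) : ℝ := A / (16 * π) + 4 * π * J ^ 2 / A

/-- At an extremal section, `A = 8π|J|`, the mass is `M² = |J|` (i.e. `|a| = |J|/M = M`). -/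
theorem kerrMassSq_extremal {J : ℝ} (hJ : J ≠ 0) : kerrMassSq (8 * π * |J|) J = |J| := by
  have hπ : (π : ℝ) ≠ 0 := Real.pi_ne_zero
  have hJ' : |J| ≠ 0 := abs_ne_zero.mpr hJ
  unfold kerrMassSq
  have h1 : 8 * π * |J| / (16 * π) = |J| / 2 := by
    field_simp
    ring
  have h2 : 4 * π * J ^ 2 / (8 * π * |J|) = |J| / 2 := by
    rw [← sq_abs J]
    field_simp
    ring
  rw [h1, h2]
  ring

/-- **Zero temperature.** `∂_A M² = 1/(16π) − 4πJ²/A²` vanishes at `A = 8π|J|`: the surface gravity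
`κ = 8π ∂M/∂A` of an extremal section is zero. [cite: BardeenCarterHawking1973, first law] -/
theorem hasDerivAt_kerrMassSq_area_extremal {J : ℝ} (hJ : J ≠ 0) :
    HasDerivAt (fun A ↦ kerrMassSq A J) 0 (8 * π * |J|) := by
  have hπ : (0 : ℝ) < π := Real.pi_pos
  have hJ' : 0 < |J| := abs_pos.mpr hJ
  have hA : (8 * π * |J|) ≠ 0 := by positivity
  have h1 : HasDerivAt (fun A : ℝ ↦ A / (16 * π)) (1 / (16 * π)) (8 * π * |J|) := by
    simpa using (hasDerivAt_id (8 * π * |J|)).div_const (16 * π)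
  have h2 : HasDerivAt (fun A : ℝ ↦ 4 * π * J ^ 2 * A⁻¹)
      (4 * π * J ^ 2 * (-((8 * π * |J|) ^ 2)⁻¹)) (8 * π * |J|) :=
    (hasDerivAt_inv hA).const_mul (4 * π * J ^ 2)
  have hsum := h1.add h2
  have hfun : (fun A ↦ kerrMassSq A J) = fun A ↦ A / (16 * π) + 4 * π * J ^ 2 * A⁻¹ := by
    funext A; simp [kerrMassSq, div_eq_mul_inv]
  have hval : 1 / (16 * π) + 4 * π * J ^ 2 * (-((8 * π * |J|) ^ 2)⁻¹) = 0 := by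
    rw [← sq_abs J]
    field_simp
    ring
  rw [hfun, ← hval]
  exact hsum

/-- **The first law at zero temperature, in closed form (every direction).** At an extremal
isolated-horizon section (`A₀ = 8π|J₀|`, `J₀ ≠ 0`) the extremality defect `M(A,J)² − |J|` is
stationary along EVERY line `τ ↦ (A₀ + τ·dA, J₀ + τ·dJ)`:
`δ(M_H² − |J_H|) = 2M(κ/8π) δA + (2MΩ_H − sgn J) δJ = 0` because `κ = 0` and `Ω_H = sgn J/(2M)`.
Consequence used by card B: on a background whose event horizon is an isolated extremal horizon from
the initial slice on (zero first-order vacuum flux through a shear-free horizon, so the late charges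
vary only through the early section's `(δA, δJ)`), NO tame data perturbation changes the final
parameter ratio at first order — the degenerate stratum contains the isolated-horizon (Kehle–Unger)
data; the card conjectures the converse. [cite: BardeenCarterHawking1973, first law;
AshtekarBeetleLewandowski2001, isolated-horizon first law] -/
theorem hasDerivAt_extremalityDefect_line {J₀ : ℝ} (hJ : J₀ ≠ 0) (dA dJ : ℝ) :
    HasDerivAt (fun τ : ℝ ↦ kerrMassSq (8 * π * |J₀| + τ * dA) (J₀ + τ * dJ) - |J₀ + τ * dJ|)
      0 0 := by
  have hπ : (0 : ℝ) < π := Real.pi_pos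
  have hJ' : 0 < |J₀| := abs_pos.mpr hJ
  have hA : (8 * π * |J₀|) ≠ 0 := by positivity
  -- the two affine coordinate functions
  have hAτ : HasDerivAt (fun τ : ℝ ↦ 8 * π * |J₀| + τ * dA) dA 0 := by
    simpa using ((hasDerivAt_id (0 : ℝ)).mul_const dA).const_add (8 * π * |J₀|)
  have hJτ : HasDerivAt (fun τ : ℝ ↦ J₀ + τ * dJ) dJ 0 := by
    simpa using ((hasDerivAt_id (0 : ℝ)).mul_const dJ).const_add J₀
  -- term 1: `A/(16π)`
  have t1 : HasDerivAt (fun τ : ℝ ↦ (8 * π * |J₀| + τ * dA) / (16 * π)) (dA / (16 * π)) 0 :=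
    hAτ.div_const (16 * π)
  -- term 2: `4π J² / A`
  have hA0 : (fun τ : ℝ ↦ 8 * π * |J₀| + τ * dA) 0 ≠ 0 := by simpa using hA
  have t2 : HasDerivAt (fun τ : ℝ ↦ 4 * π * (J₀ + τ * dJ) ^ 2 / (8 * π * |J₀| + τ * dA))
      ((4 * π * (2 * J₀ * dJ) * (8 * π * |J₀|) - 4 * π * J₀ ^ 2 * dA) / (8 * π * |J₀|) ^ 2)
      0 := by
    have hsq : HasDerivAt (fun τ : ℝ ↦ 4 * π * (J₀ + τ * dJ) ^ 2) (4 * π * (2 * J₀ * dJ)) 0 := by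
      refine ((hJτ.pow 2).const_mul (4 * π)).congr_deriv ?_
      norm_num
    refine (hsq.div hAτ hA0).congr_deriv ?_
    norm_num
  -- term 3: `|J|`, which near `τ = 0` is `sgn(J₀) · J`
  have t3 : HasDerivAt (fun τ : ℝ ↦ |J₀ + τ * dJ|) ((SignType.sign J₀ : ℝ) * dJ) 0 := by
    have hcont : Tendsto (fun τ : ℝ ↦ J₀ + τ * dJ) (𝓝 0) (𝓝 J₀) := by
      simpa using hJτ.continuousAt.tendsto
    rcases lt_or_gt_of_ne hJ with hneg | hpos
    · have hev : (fun τ : ℝ ↦ |J₀ + τ * dJ|) =ᶠ[𝓝 0] fun τ ↦ -(J₀ + τ * dJ) :=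
        (hcont.eventually (gt_mem_nhds hneg)).mono fun τ hτ ↦ abs_of_neg hτ
      rw [sign_neg hneg]
      simpa using (hJτ.neg).congr_of_eventuallyEq hev
    · have hev : (fun τ : ℝ ↦ |J₀ + τ * dJ|) =ᶠ[𝓝 0] fun τ ↦ J₀ + τ * dJ :=
        (hcont.eventually (lt_mem_nhds hpos)).mono fun τ hτ ↦ abs_of_pos hτ
      rw [sign_pos hpos]
      simpa using hJτ.congr_of_eventuallyEq hev
  have total := (t1.add t2).sub t3
  -- identify the function and evaluate the derivative: it vanishes (first law, κ = 0)
  have hfun : (fun τ : ℝ ↦ kerrMassSq (8 * π * |J₀| + τ * dA) (J₀ + τ * dJ) - |J₀ + τ * dJ|) =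
      fun τ ↦ (8 * π * |J₀| + τ * dA) / (16 * π) +
        4 * π * (J₀ + τ * dJ) ^ 2 / (8 * π * |J₀| + τ * dA) - |J₀ + τ * dJ| := by
    funext τ; simp [kerrMassSq]
  have hsgn : (SignType.sign J₀ : ℝ) * |J₀| = J₀ := by
    rcases lt_or_gt_of_ne hJ with hneg | hpos
    · rw [sign_neg hneg, abs_of_neg hneg]; simp
    · rw [sign_pos hpos, abs_of_pos hpos]; simp
  have hval : dA / (16 * π) +
      (4 * π * (2 * J₀ * dJ) * (8 * π * |J₀|) - 4 * π * J₀ ^ 2 * dA) / (8 * π * |J₀|) ^ 2 -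
      (SignType.sign J₀ : ℝ) * dJ = 0 := by
    have hsq : J₀ ^ 2 = |J₀| ^ 2 := (sq_abs J₀).symm
    rw [hsq]
    have hs : (SignType.sign J₀ : ℝ) = J₀ / |J₀| := by
      rw [eq_div_iff hJ'.ne', hsgn]
    rw [hs]
    field_simp
    ring
  rw [hfun]
  exact total.congr_deriv hval

/-! ## §B2 (remark R) Regular-or-residual bookkeeping (typed) and how the levers compose -/

/-- **Tame-regular at `d`** for a real observable `σ` of admissible data (for the crux: the final
parameter ratio `|a_f|/M_f` of the asymptotically extremal hole of `d`'s development, read from the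
black-hole side): some tame injective immersed admissible CURVE through `d` moves `σ` at first order.
Card B's dichotomy: an extremal-threshold datum is tame-regular unless its event horizon is already
an isolated (extremal) horizon from the initial slice on. -/
def TameRegularAt (𝓓 : Set (InitialDataSet (𝓡 3) X)) (σ : InitialDataSet (𝓡 3) X → ℝ)
    (d : InitialDataSet (𝓡 3) X) : Prop :=
  ∃ (e : AFEnd X) (F : EuclideanSpace ℝ (Fin 1) → InitialDataSet (𝓡 3) X),
    IsTameDataFamily e 1 F ∧ IsImmersedAtZero 1 F ∧ Injective F ∧ F 0 = d ∧ (∀ c, F c ∈ 𝓓) ∧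
      deriv (fun c : ℝ ↦ σ (F (EuclideanSpace.single 0 c))) 0 ≠ 0

/-- **Area frozen from `v₀` on**: along an advanced-time slicing of the event horizon the section
area is constant for `v ≥ v₀` — the typed shadow (over the landed `EventHorizonArea`) of "the event
horizon to the future of the slice is a non-expanding (hence, in vacuum, shear-free: isolated)
horizon", the degenerate branch of card B. -/
def AreaFrozenFrom [ConnectedSpace X]
    {D : InitialDataSet (𝓡 3) X} {𝒟 : CauchyDevelopment D} {U : Set 𝒟.carrier}
    (A : EventHorizonArea 𝒟 U) (v₀ : ℝ) : Prop :=
  ∀ v, v₀ ≤ v → A.horizonArea v = A.horizonArea v₀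

/-- **Zero-temperature dichotomy (card B, kernel statement).** Every datum of the extremal-threshold
stratum `Thr` is EITHER tame-regular for the final parameter ratio `σ` OR isolated-from-the-slice
(`Iso`, to be instantiated by `AreaFrozenFrom` on the development's event horizon). The direction
`Iso d → ¬ TameRegularAt` is the first law at zero temperature (`hasDerivAt_extremalityDefect_line`
+ zero first-order vacuum flux through a shear-free horizon); the content is the converse. -/
def ZeroTemperatureDichotomy (𝓓 : Set (InitialDataSet (𝓡 3) X)) (σ : InitialDataSet (𝓡 3) X → ℝ)
    (Thr Iso : InitialDataSet (𝓡 3) X → Prop) : Prop :=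
  ∀ d ∈ 𝓓, Thr d → TameRegularAt 𝓓 σ d ∨ Iso d

/-- **How the levers compose under the dichotomy** (pure bookkeeping): if the threshold stratum
splits as regular ∨ isolated, the fold (card A) escapes regular data and the K-flux seed
(card kflux-seeds-the-ratchet) escapes isolated data, then every threshold datum is escaped —
locally in the parameter, which suffices (`isTameChristodoulouGeneric_of_local`). [folklore] -/
theorem escape_of_dichotomy {𝓓 : Set (InitialDataSet (𝓡 3) X)} {σ : InitialDataSet (𝓡 3) X → ℝ}
    {Thr Iso Good : InitialDataSet (𝓡 3) X → Prop}
    (hdich : ZeroTemperatureDichotomy 𝓓 σ Thr Iso)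
    (hfold : ∀ d ∈ 𝓓, Thr d → TameRegularAt 𝓓 σ d →
      ∃ (e : AFEnd X) (F : EuclideanSpace ℝ (Fin 1) → InitialDataSet (𝓡 3) X),
        IsTameDataFamily e 1 F ∧ IsImmersedAtZero 1 F ∧ F 0 = d ∧ Injective F ∧
          (∀ c, F c ∈ 𝓓) ∧ ∃ ε > (0 : ℝ), ∀ c, c ≠ 0 → ‖c‖ < ε → Good (F c))
    (hseed : ∀ d ∈ 𝓓, Thr d → Iso d →
      ∃ (e : AFEnd X) (F : EuclideanSpace ℝ (Fin 1) → InitialDataSet (𝓡 3) X),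
        IsTameDataFamily e 1 F ∧ IsImmersedAtZero 1 F ∧ F 0 = d ∧ Injective F ∧
          (∀ c, F c ∈ 𝓓) ∧ ∃ ε > (0 : ℝ), ∀ c, c ≠ 0 → ‖c‖ < ε → Good (F c)) :
    ∀ d ∈ 𝓓, Thr d →
      ∃ (e : AFEnd X) (F : EuclideanSpace ℝ (Fin 1) → InitialDataSet (𝓡 3) X),
        IsTameDataFamily e 1 F ∧ IsImmersedAtZero 1 F ∧ F 0 = d ∧ Injective F ∧
          (∀ c, F c ∈ 𝓓) ∧ ∃ ε > (0 : ℝ), ∀ c, c ≠ 0 → ‖c‖ < ε → Good (F c) := by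
  intro d hd hThr
  rcases hdich d hd hThr with hreg | hiso
  · exact hfold d hd hThr hreg
  · exact hseed d hd hThr hiso

/-- If moreover EVERY exceptional datum is a threshold datum (the census / censorship residual of the
line, conceded here as a hypothesis `hcover`), tame genericity follows. [folklore] -/
theorem isTameChristodoulouGeneric_of_dichotomy {𝓓 : Set (InitialDataSet (𝓡 3) X)}
    {σ : InitialDataSet (𝓡 3) X → ℝ} {Thr Iso Good : InitialDataSet (𝓡 3) X → Prop}
    (hcover : ∀ d ∈ 𝓓, ¬ Good d → Thr d)
    (hdich : ZeroTemperatureDichotomy 𝓓 σ Thr Iso)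
    (hfold : ∀ d ∈ 𝓓, Thr d → TameRegularAt 𝓓 σ d →
      ∃ (e : AFEnd X) (F : EuclideanSpace ℝ (Fin 1) → InitialDataSet (𝓡 3) X),
        IsTameDataFamily e 1 F ∧ IsImmersedAtZero 1 F ∧ F 0 = d ∧ Injective F ∧
          (∀ c, F c ∈ 𝓓) ∧ ∃ ε > (0 : ℝ), ∀ c, c ≠ 0 → ‖c‖ < ε → Good (F c))
    (hseed : ∀ d ∈ 𝓓, Thr d → Iso d →
      ∃ (e : AFEnd X) (F : EuclideanSpace ℝ (Fin 1) → InitialDataSet (𝓡 3) X),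
        IsTameDataFamily e 1 F ∧ IsImmersedAtZero 1 F ∧ F 0 = d ∧ Injective F ∧
          (∀ c, F c ∈ 𝓓) ∧ ∃ ε > (0 : ℝ), ∀ c, c ≠ 0 → ‖c‖ < ε → Good (F c)) :
    IsTameChristodoulouGeneric 𝓓 Good 1 :=
  isTameChristodoulouGeneric_of_local fun d hd hnot ↦
    escape_of_dichotomy hdich hfold hseed d hd (hcover d hd hnot)

end Summit.FinalStateConjecture.FinalStateConjecture.Cruxes.TameCensorshipCollarMargin.Ideator4

end
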